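import Mathlib
import HarnessLib
import Summits.HubbardSuperconductivity.HubbardSuperconductivity.Theorems.KLProgrammeKLRegimeEngineTwoLegStepV17F2ClosersDual

/-!
# Route `KLProgramme` — ENGINE child gen 8 (stmt-HubbardSuperconductivity-20437), stub (e) residual B: the UNSECTORISED two-leg moments FROM THE PAIR
# TABLE OF A COMPLETE MULTIPLIER FAMILY (cell gate-hubbard-kl, seat hubbard-kl-r2d-p1 g7, class-#7 text owner)

The consumer shells of stub (e) in dual-lattice currency (`stub_twoLeg_step_of_dualMoments_GQ[J]`, p540781 / p546067; class-#7 atoms `TwoLegMomentsAt` /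
`TwoLegMomentBoundsAt`) read the two first moments of the TRIVIAL-multiplier position-space two-leg kernel of `𝒱⁽ⁿ⁾[K_n] − 𝒩_{K_n}`.  A sectorised tower bounds
the kernels whose legs carry the members `F_ω` of a multiplier family.  `sectorisedKernel` is MULTILINEAR in the leg multipliers, so for a COMPLETE family
(`Σ_ω F_ω(k) = 1` at every frequency–momentum `k`, e.g. the shell members plus one complement member) the trivial-multiplier kernel is the sum of the
family kernels over all label tuples, and every weighted pinned sum of its norm is at most the sum of the same quantity over the tuples:

* §1 `sum_prod_family_eq_one` (`Σ_{ω : Fin m → Fin N} ∏_i F_{ω i}(k_i) = 1`), **`sectorisedKernel_trivialMultiplier_eq_sum_family`** (any degree `m`, any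
  spin/charge string), `norm_sectorisedKernel_trivialMultiplier_le_sum_family`;
* §2 **`sum_wt_norm_sectorisedKernel_trivialMultiplier_le_sum_family`** — for any finite set `A` of position tuples and any nonnegative weight `w`,
  `Σ_{x ∈ A} w(x)·‖W_triv(x)‖ ≤ Σ_ω Σ_{x ∈ A} w(x)·‖W_ω(x)‖`;
* §3 the two-leg rows: **`twoLeg_timeMoment_le_of_family`** / **`twoLeg_spaceMoment_le_of_family`** — the `hMt` / `hMs` rows of
  `stub_twoLeg_step_of_dualMoments_GQ` for `G' = klEffectiveAction … K klE0 n − counterQuadratic … K` (any `K`, `n`) from a PAIR TABLE of budgets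
  `Mt ω₀ ω₁`, `Ms ω₀ ω₁` of the `(ω₀, ω₁)`-sectorised kernels of `G'`: budgets `Σ_{ω₀,ω₁} Mt ω₀ ω₁`, `Σ_{ω₀,ω₁} Ms ω₀ ω₁`.

So a sectorised supplier serves BOTH rows B1′ and B2′ of stub (e) (through `…_dualMoments_GQJ` / the class-#7 raw atom) as soon as its family is complete and it
tabulates the pair moments — the complement pairs included.  Proofs only; no definitions; nothing about the Hubbard model is asserted; nothing asserts
superconductivity.  References: BGM 2006 §2.3 (2.17), §2.7 (2.70)–(2.71) [cite: BenfattoGiulianiMastropietro2006].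
-/

noncomputable section

namespace Summit.HubbardSuperconductivity.HubbardSuperconductivity.Theorems.TwoLegFourier

set_option linter.dupNamespace false -- summit = problem name (single-conjunct summit), D-0017

open Finset Complex
open Literature.MathematicalPhysics.QuantumLattice Literature.Probability.LatticeModels GrassmannAlgebra
open Summit.HubbardSuperconductivity.HubbardSuperconductivity.Theorems.KLRegimeSplit
open Summit.HubbardSuperconductivity.HubbardSuperconductivity.Theorems.KLProgrammeLegKernels

variable {L M : ℕ} [NeZero L] {N : ℕ}

/-! ## §1 Multilinearity in the leg multipliers: a complete family reproduces the trivial kernel -/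

omit [NeZero L] in
/-- For a complete family, the label sum of the products of the leg multipliers is `1`. -/
theorem sum_prod_family_eq_one {F : Fin N → FreqMomentum L M → ℂ} (hF : ∀ k, ∑ ω, F ω k = 1) {m : ℕ} (k : Fin m → FreqMomentum L M) :
    ∑ ω : Fin m → Fin N, ∏ i, F (ω i) (k i) = 1 := by
  rw [← Fintype.prod_sum (fun i a => F a (k i))]
  simp [hF]

/-- **A COMPLETE FAMILY REPRODUCES THE TRIVIAL-MULTIPLIER KERNEL**: if `Σ_ω F_ω(k) = 1` at every `k`, then for every degree `m`, every spin/charge string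
`sc` and every position tuple `x`, `W_triv(sc; x) = Σ_{ω : Fin m → Fin N} W_F((ω_i, sc_i)_i; x)`. -/
theorem sectorisedKernel_trivialMultiplier_eq_sum_family (β : ℝ) {F : Fin N → FreqMomentum L M → ℂ} (hF : ∀ k, ∑ ω, F ω k = 1)
    (G : HubbardGrassmann L M) (m : ℕ) (sc : Fin m → Fin 2 × Fin 2) (x : Fin m → SpaceTimeIdx L M) :
    sectorisedKernel L M β (trivialMultiplier L M) G m (fun i => (((0 : Fin 1), (sc i).1), (sc i).2)) x =
      ∑ ω : Fin m → Fin N, sectorisedKernel L M β F G m (fun i => ((ω i, (sc i).1), (sc i).2)) x := by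
  simp only [sectorisedKernel_def, trivialMultiplier, one_mul]
  rw [sum_comm]
  refine sum_congr rfl fun k _ => ?_
  rw [← sum_mul]
  congr 1
  have h : ∀ ω : Fin m → Fin N, (∏ i, F (ω i) (k i) * hubbardPlaneWave L M β (sc i).2 (k i) (x i)) =
      (∏ i, F (ω i) (k i)) * ∏ i, hubbardPlaneWave L M β (sc i).2 (k i) (x i) := fun ω => by
    rw [← prod_mul_distrib]
  simp_rw [h]
  rw [← sum_mul, sum_prod_family_eq_one hF k, one_mul]

/-- The norm form: `‖W_triv(x)‖ ≤ Σ_ω ‖W_ω(x)‖`. -/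
theorem norm_sectorisedKernel_trivialMultiplier_le_sum_family (β : ℝ) {F : Fin N → FreqMomentum L M → ℂ} (hF : ∀ k, ∑ ω, F ω k = 1)
    (G : HubbardGrassmann L M) (m : ℕ) (sc : Fin m → Fin 2 × Fin 2) (x : Fin m → SpaceTimeIdx L M) :
    ‖sectorisedKernel L M β (trivialMultiplier L M) G m (fun i => (((0 : Fin 1), (sc i).1), (sc i).2)) x‖ ≤
      ∑ ω : Fin m → Fin N, ‖sectorisedKernel L M β F G m (fun i => ((ω i, (sc i).1), (sc i).2)) x‖ := by
  rw [sectorisedKernel_trivialMultiplier_eq_sum_family β hF G m sc x]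
  exact norm_sum_le _ _

/-! ## §2 Weighted pinned sums -/

/-- **WEIGHTED SUMS OF THE TRIVIAL KERNEL ARE DOMINATED BY THE FAMILY TABLE**: for a complete family, any finite set `A` of position tuples and any
nonnegative weight `w`, `Σ_{x ∈ A} w(x)·‖W_triv(x)‖ ≤ Σ_ω Σ_{x ∈ A} w(x)·‖W_ω(x)‖`. -/
theorem sum_wt_norm_sectorisedKernel_trivialMultiplier_le_sum_family (β : ℝ) {F : Fin N → FreqMomentum L M → ℂ} (hF : ∀ k, ∑ ω, F ω k = 1)
    (G : HubbardGrassmann L M) (m : ℕ) (sc : Fin m → Fin 2 × Fin 2) (A : Finset (Fin m → SpaceTimeIdx L M))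
    {w : (Fin m → SpaceTimeIdx L M) → ℝ} (hw : ∀ x ∈ A, 0 ≤ w x) :
    ∑ x ∈ A, w x * ‖sectorisedKernel L M β (trivialMultiplier L M) G m (fun i => (((0 : Fin 1), (sc i).1), (sc i).2)) x‖ ≤
      ∑ ω : Fin m → Fin N, ∑ x ∈ A, w x * ‖sectorisedKernel L M β F G m (fun i => ((ω i, (sc i).1), (sc i).2)) x‖ := by
  rw [sum_comm]
  refine sum_le_sum fun x hx => ?_
  rw [← mul_sum]
  exact mul_le_mul_of_nonneg_left (norm_sectorisedKernel_trivialMultiplier_le_sum_family β hF G m sc x) (hw x hx)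

/-! ## §3 The two-leg rows of stub (e) from a pair table -/

section TwoLeg

/-- The two-leg label string `((0,σ),+),((0,σ),−)` as a spin/charge string. -/
private theorem twoLeg_string_eq (σ : Fin 2) :
    (![(((0 : Fin 1), σ), 0), (((0 : Fin 1), σ), 1)] : Fin 2 → SectorLeg 1) =
      fun i => (((0 : Fin 1), ((![(σ, 0), (σ, 1)] : Fin 2 → Fin 2 × Fin 2) i).1), ((![(σ, 0), (σ, 1)] : Fin 2 → Fin 2 × Fin 2) i).2) := by
  funext i; fin_cases i <;> rfl

/-- The family two-leg label string `((ω₀,σ),+),((ω₁,σ),−)` as a spin/charge string with labels `![ω₀, ω₁]`. -/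
private theorem twoLeg_family_string_eq (σ : Fin 2) (ω : Fin 2 → Fin N) :
    (fun i => ((ω i, ((![(σ, 0), (σ, 1)] : Fin 2 → Fin 2 × Fin 2) i).1), ((![(σ, 0), (σ, 1)] : Fin 2 → Fin 2 × Fin 2) i).2)) =
      (![((ω 0, σ), 0), ((ω 1, σ), 1)] : Fin 2 → SectorLeg N) := by
  funext i; fin_cases i <;> rfl

/-- **ROW B1′ INPUT (`hMt`) FROM A PAIR TABLE**: for a complete family `F`, `G' = klEffectiveAction … K klE0 n − counterQuadratic … K`, and budgets `Mt ω₀ ω₁` of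
the circular time first moments of the `(ω₀,ω₁)`-sectorised kernels of `G'` (both spins, every pin), the trivial-multiplier time moment is
`≤ Σ_{ω : Fin 2 → Fin N} Mt (ω 0) (ω 1)`. -/
theorem twoLeg_timeMoment_le_of_family {β : ℝ} (hβ : 0 ≤ β) (U μ : ℝ) (K : TrigPolyC4v) (n : ℕ) {F : Fin N → FreqMomentum L M → ℂ}
    (hF : ∀ k, ∑ ω, F ω k = 1) {Mt : Fin N → Fin N → ℝ}
    (hMt : ∀ (ω₀ ω₁ : Fin N) (σ : Fin 2) (x₀ : SpaceTimeIdx L M), imagTimeWeight β M *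
      ∑ x ∈ (univ : Finset (Fin 2 → SpaceTimeIdx L M)).filter (fun x => x 0 = x₀),
        imagTimeWeight β M * (circDist (2 * M) (x 0).1.val (x 1).1.val : ℝ) *
          ‖sectorisedKernel L M β F (klEffectiveAction L M β U μ K klE0 n - counterQuadratic L M β K) 2
            (![((ω₀, σ), 0), ((ω₁, σ), 1)] : Fin 2 → SectorLeg N) x‖ ≤ Mt ω₀ ω₁)
    (σ : Fin 2) (x₀ : SpaceTimeIdx L M) :
    imagTimeWeight β M *
      ∑ x ∈ (univ : Finset (Fin 2 → SpaceTimeIdx L M)).filter (fun x => x 0 = x₀),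
        imagTimeWeight β M * (circDist (2 * M) (x 0).1.val (x 1).1.val : ℝ) *
          ‖sectorisedKernel L M β (trivialMultiplier L M) (klEffectiveAction L M β U μ K klE0 n - counterQuadratic L M β K) 2
            (![((0, σ), 0), ((0, σ), 1)] : Fin 2 → SectorLeg 1) x‖ ≤ ∑ ω : Fin 2 → Fin N, Mt (ω 0) (ω 1) := by
  have hε : 0 ≤ imagTimeWeight β M := imagTimeWeight_nonneg hβ M
  set G' := klEffectiveAction L M β U μ K klE0 n - counterQuadratic L M β K with hG'
  rw [twoLeg_string_eq σ]
  have h := sum_wt_norm_sectorisedKernel_trivialMultiplier_le_sum_family β hF G' 2 (![(σ, 0), (σ, 1)] : Fin 2 → Fin 2 × Fin 2)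
    ((univ : Finset (Fin 2 → SpaceTimeIdx L M)).filter (fun x => x 0 = x₀))
    (w := fun x => imagTimeWeight β M * (circDist (2 * M) (x 0).1.val (x 1).1.val : ℝ)) (fun x _ => by positivity)
  refine (mul_le_mul_of_nonneg_left h hε).trans ?_
  rw [mul_sum]
  refine sum_le_sum fun ω _ => ?_
  rw [twoLeg_family_string_eq σ ω]
  exact hMt (ω 0) (ω 1) σ x₀

/-- **ROW B2′ INPUT (`hMs`) FROM A PAIR TABLE**: the off-diagonal first space moment of the trivial-multiplier two-leg kernel of `G'` is
`≤ Σ_{ω : Fin 2 → Fin N} Ms (ω 0) (ω 1)` for a complete family with pair budgets `Ms ω₀ ω₁`. -/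
theorem twoLeg_spaceMoment_le_of_family {β : ℝ} (hβ : 0 ≤ β) (U μ : ℝ) (K : TrigPolyC4v) (n : ℕ) {F : Fin N → FreqMomentum L M → ℂ}
    (hF : ∀ k, ∑ ω, F ω k = 1) {Ms : Fin N → Fin N → ℝ}
    (hMs : ∀ (ω₀ ω₁ : Fin N) (σ : Fin 2) (x₀ : SpaceTimeIdx L M), imagTimeWeight β M *
      ∑ x ∈ (univ : Finset (Fin 2 → SpaceTimeIdx L M)).filter (fun x => x 0 = x₀ ∧ (x 1).2 ≠ (x 0).2),
        (1 + ((((x 1).2 - (x 0).2) 0).valMinAbs.natAbs : ℝ) + ((((x 1).2 - (x 0).2) 1).valMinAbs.natAbs : ℝ)) ^ 1 *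
          ‖sectorisedKernel L M β F (klEffectiveAction L M β U μ K klE0 n - counterQuadratic L M β K) 2
            (![((ω₀, σ), 0), ((ω₁, σ), 1)] : Fin 2 → SectorLeg N) x‖ ≤ Ms ω₀ ω₁)
    (σ : Fin 2) (x₀ : SpaceTimeIdx L M) :
    imagTimeWeight β M *
      ∑ x ∈ (univ : Finset (Fin 2 → SpaceTimeIdx L M)).filter (fun x => x 0 = x₀ ∧ (x 1).2 ≠ (x 0).2),
        (1 + ((((x 1).2 - (x 0).2) 0).valMinAbs.natAbs : ℝ) + ((((x 1).2 - (x 0).2) 1).valMinAbs.natAbs : ℝ)) ^ 1 *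
          ‖sectorisedKernel L M β (trivialMultiplier L M) (klEffectiveAction L M β U μ K klE0 n - counterQuadratic L M β K) 2
            (![((0, σ), 0), ((0, σ), 1)] : Fin 2 → SectorLeg 1) x‖ ≤ ∑ ω : Fin 2 → Fin N, Ms (ω 0) (ω 1) := by
  have hε : 0 ≤ imagTimeWeight β M := imagTimeWeight_nonneg hβ M
  set G' := klEffectiveAction L M β U μ K klE0 n - counterQuadratic L M β K with hG'
  rw [twoLeg_string_eq σ]
  have h := sum_wt_norm_sectorisedKernel_trivialMultiplier_le_sum_family β hF G' 2 (![(σ, 0), (σ, 1)] : Fin 2 → Fin 2 × Fin 2)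
    ((univ : Finset (Fin 2 → SpaceTimeIdx L M)).filter (fun x => x 0 = x₀ ∧ (x 1).2 ≠ (x 0).2))
    (w := fun x => (1 + ((((x 1).2 - (x 0).2) 0).valMinAbs.natAbs : ℝ) + ((((x 1).2 - (x 0).2) 1).valMinAbs.natAbs : ℝ)) ^ 1)
    (fun x _ => by positivity)
  refine (mul_le_mul_of_nonneg_left h hε).trans ?_
  rw [mul_sum]
  refine sum_le_sum fun ω _ => ?_
  rw [twoLeg_family_string_eq σ ω]
  exact hMs (ω 0) (ω 1) σ x₀

end TwoLeg

end Summit.HubbardSuperconductivity.HubbardSuperconductivity.Theorems.TwoLegFourier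

end
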